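import Summits.QuantumFields.YangMills.Theorems.FradkinShenkerFlowClusteringToYangMillsStubGapFromClustering
import Summits.QuantumFields.YangMills.Theorems.EquipartitionCriticalityCriticalContinuumLimitStubAdmissibleGivesGapLTwo
import Summits.QuantumFields.YangMills.Theorems.EquipartitionCriticalityCriticalContinuumLimitStubAdmissibleGivesGapTorusRP
import Summits.QuantumFields.YangMills.Theorems.EquipartitionCriticalityCriticalContinuumLimitStubAdmissibleGivesGapGauge
import Summits.QuantumFields.YangMills.Theorems.EquipartitionCriticalityCriticalContinuumLimitStubAdmissibleGivesGapGaugeInvariance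
import HarnessLib

/-!
# An admissible torus clustering rate is an infinite-volume transfer gap

Support file for crux `stmt-QuantumFields-8762`
(`Summit.QuantumFields.YangMills.Theses.EquipartitionCriticality.CriticalContinuumLimit`), line
`Sketch`: the registered stub `stub_admissibleGivesGap` (I0), which is verbatim the statement RQ
(`Statement.stub_requantise`) of the sibling line `spectral-requantisation-dock` of crux
`ClusteringToYangMills` (stmt-QuantumFields-9443): for a compact simple Lie group `G`, a lattice
representation `r`, `β ≥ 0` and `m > 0`, volume-uniform Euclidean-time clustering of the odd-torus
Wilson states (`TorusClusteringAt r β m`) implies `HasInfiniteVolumeGap r β m` — every odd-torus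
limit state `μ` is Osterwalder–Schrader reconstructible for the bond time reflection
`Θ = gaugeTimeReflect` (`x₀ ↦ -1 - x₀`), the unit time shift `τ = gaugeTimeShift` and the
positive-time σ-algebra `𝓔₊ = posTimeEvents G`, with transfer gap `‖T|_{Ω^⊥}‖ ≤ e^{-m}`.

It is the checked composition (`requantise_of_stubs` of that line) of
* RQ0 — `stub_cylinderApprox` (landed): `CylinderApprox μ` and `CylinderExt G`;
* RQa — **Part 1** of this file, `AdmissibleGap.isOSReconstructible_of_oddTorusLimit`;
* RQb1 — **Part 2** of this file, `AdmissibleGap.dense_osMap_span`;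
* RQb2 — `stub_gapFromClustering` (landed): the gap from clustering on a dense OS domain.

**Part 1 (RQa): odd-torus limit states are OS-reconstructible.**
* *Torus layer.* On the odd torus of side `2S+1`, Wave 0's reflection `Θ_T` (`t ↦ 1 - t`) is
  reflection positive on observables of the closed half `1 ≤ t ≤ S (+1)`
  (`wilsonExpectation_oddReflectionPositive`), hence also on observables of the reflected half
  (`oddRP_reflected`, by `Θ_T`-invariance of the Wilson state). The periodic lift intertwines
  `Θ ∘ lift = lift ∘ T_{-2e₀} ∘ Θ_T`, `τ ∘ lift = lift ∘ T_{-e₀}` (`stub_reconstructible_geometry`);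
  after a translation by `e₀` (bond plane) resp. by `(S-1) e₀` (the site plane `x₀ = 0` of `ℤ⁴`
  becomes the antipodal site plane of the torus), `Re ⟨(F∘Θ∘lift)‾ (F∘lift)⟩ ≥ 0` and
  `Re ⟨(F∘Θ∘lift)‾ (F∘τ∘lift)⟩ ≥ 0` for every bounded measurable cylinder `F` supported on links
  based at times `0 ≤ x₀ ≤ S - 2` (`torus_rp_bond`, `torus_rp_site`).
* *Limit.* For a bounded continuous cylinder `F` the real parts of the two OS integrands are bounded
  continuous cylinder observables, so RP and RP-half-a-step-up pass to `μ`
  (`re_osForm_nonneg_of_continuous`); `Θ`- and `τ`-invariance of `μ` follow from the invariances of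
  the torus states and `CylinderExt` (`map_gaugeTimeReflect_eq`, `map_gaugeTimeShift_eq`) and give
  hermitian symmetry (`Θ ∘ Θ = id`) and shift symmetry (`τ ∘ Θ ∘ τ = Θ`).
* *Extension.* RP extends from continuous cylinder observables to bounded `𝓔₊`-measurable ones by
  `CylinderApprox` and an `L²` estimate using the two invariances (`re_integral_nonneg_of_approx`).

**Part 2 (RQb1): OS density of the continuous gauge-invariant positive-time observables.**
Bounded `𝓔₊`-measurable observables are `L²`-approximated by continuous positive-time cylinder
observables (`CylinderApprox`), whose OS images move by at most the `L²` distance (`Θ`-invariance);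
a continuous positive-time cylinder observable has the same OS image as its gauge average over the
(compact) gauge group of the endpoints of its support (`osMap_eq_osMap_gaugeAvg`: the endpoints have
times `≥ 0`, so the averaged gauge transformations do not touch `F̄ ∘ Θ`; gauge invariance of `μ`
passes to the limit from `wilsonMeasure_map_gaugeTransform`, large tori matching every `ℤ⁴` gauge
transformation on a fixed finite set of sites), and the gauge average is a continuous
gauge-invariant species (`avgSpecies`; right invariance of Haar measure), whose real and
imaginary parts lie in `contPosTimeObs G` (`gaugeAvg_mem_span`).

**Part 3:** the registered stub `CriticalContinuumLimit.stub_admissibleGivesGap`.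

References: K. Osterwalder, E. Seiler, Ann. Phys. 110 (1978) 440, §2; E. Seiler, LNP 159 (1982)
Ch. 2; J. Glimm, A. Jaffe, *Quantum Physics* (1987) §6.1 (Prop. 6.1.1, Thm. 6.1.3) and §19.7;
J. Fröhlich, R. Israel, E. Lieb, B. Simon, Comm. Math. Phys. 62 (1978) 1, §2–3.
-/

noncomputable section

open scoped BigOperators Topology ENNReal ComplexConjugate ComplexOrder
open MeasureTheory Filter
open Literature.MathematicalPhysics Literature.MathematicalPhysics.QuantumFieldTheory
  Literature.MathematicalPhysics.QuantumLattice
open Literature.Probability.LatticeModels (IsOSReconstructible IsBoundedMeasurable positiveEvents osForm)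

namespace Summit.QuantumFields.YangMills.Theorems.CriticalContinuumLimit.AdmissibleGap

open Summit.QuantumFields.YangMills.Theorems.ClusteringToYangMills
open Summit.QuantumFields.YangMills.Theorems.ClusteringToYangMills.Reconstructible

/-! ### RQa: OS reconstructibility of odd-torus limit states -/

section Main

variable {G : Type} [Group G] [TopologicalSpace G] [IsTopologicalGroup G] [CompactSpace G]
  [MeasurableSpace G] [BorelSpace G]

/-- **RQa — odd-torus limit states are OS-reconstructible** for the bond time reflection
`gaugeTimeReflect`, the unit time shift `gaugeTimeShift` and the positive-time σ-algebra
`posTimeEvents G`: reflection positivity (`wilsonExpectation_oddReflectionPositive` on the torus,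
translated by one unit) and reflection positivity half a step up (the same theorem at the
antipodal site plane of the odd torus) pass to the limit on continuous cylinder observables and
extend to bounded `𝓔₊`-measurable ones by `CylinderApprox`; hermitian symmetry and shift symmetry are
`Θ`- and `τ`-invariance of the limit state (`CylinderExt`). (Osterwalder–Seiler 1978 §2;
Glimm–Jaffe 1987 Thm. 6.1.3; FILS 1978 §3.) [folklore] -/
theorem isOSReconstructible_of_oddTorusLimit (r : LatticeRep G) {β : ℝ} (hβ : 0 ≤ β)
    (μ : Measure (LGConfig 4 G)) [IsProbabilityMeasure μ] (hμ : μ ∈ oddTorusLimitPoints r β)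
    (hAP : CylinderApprox μ) (hExt : CylinderExt G) :
    IsOSReconstructible μ gaugeTimeReflect gaugeTimeShift (posTimeEvents G) := by
  obtain ⟨eΘ, heΘ⟩ := exists_measurableEquiv_gaugeTimeReflect (G := G)
  set eτ : LGConfig 4 G ≃ᵐ LGConfig 4 G := configShift (G := G) (-(Pi.single (0 : Fin 4) (1 : ℤ)))
    with heτdef
  have heτ : (eτ : LGConfig 4 G → LGConfig 4 G) = gaugeTimeShift := rfl
  have hμΘ : μ.map eΘ = μ := by rw [heΘ]; exact map_gaugeTimeReflect_eq r hμ hExt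
  have hμτ : μ.map eτ = μ := by rw [heτ]; exact map_gaugeTimeShift_eq r hμ hExt
  have hμid : μ.map (MeasurableEquiv.refl (LGConfig 4 G)) = μ := Measure.map_id
  -- reflection positivity, for `σ = id` and `σ = τ`, via approximation
  have hRP : ∀ (eσ : LGConfig 4 G ≃ᵐ LGConfig 4 G), μ.map eσ = μ →
      ((eσ : LGConfig 4 G → LGConfig 4 G) = id ∨ (eσ : LGConfig 4 G → LGConfig 4 G) = gaugeTimeShift) →
      ∀ F, IsBoundedMeasurable (posTimeEvents G) F →
        0 ≤ (∫ U, conj (F (eΘ U)) * F (eσ U) ∂μ).re := by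
    intro eσ hμσ hσ F hF
    obtain ⟨hFm, C, hC⟩ := hF
    refine re_integral_nonneg_of_approx μ eΘ eσ hμΘ hμσ (hFm.mono cylinderEvents_le_pi le_rfl) hC
      fun ε hε => ?_
    obtain ⟨F', Λ, hΛ, hcyl, hcont, hF'm, hF'b, hE⟩ := hAP F ⟨hFm, C, hC⟩ ε hε
    have hF'm' : Measurable F' := hF'm.mono cylinderEvents_le_pi le_rfl
    refine ⟨F', hF'm', hF'b, hE, ?_⟩
    have key := re_osForm_nonneg_of_continuous r hβ hμ hcont hF'm' hF'b hcyl hΛ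
    rw [heΘ]
    rcases hσ with hσ | hσ
    · rw [hσ]; exact key.1
    · rw [hσ]; exact key.2
  refine
    { le := cylinderEvents_le_pi
      measurable_reflect := measurable_gaugeTimeReflect
      rp := fun F hF => ?_
      conj_symm := fun F G' hF hG' => ?_
      measurable_comp_shift := fun G' hG' => hG'.comp measurable_gaugeTimeShift_posTimeEvents
      shift_symm := fun F G' hF hG' => ?_
      rp_shift := fun F hF => ?_ }
  · -- reflection positivity
    have h := hRP (MeasurableEquiv.refl _) hμid (Or.inl rfl) F hF
    simpa only [osForm, heΘ, MeasurableEquiv.refl_apply] using h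
  · -- hermitian symmetry from `Θ`-invariance and `Θ ∘ Θ = id`
    simp only [osForm, ← integral_conj, map_mul, Complex.conj_conj]
    rw [← integral_comp_equiv_eq μ eΘ hμΘ (fun U => conj (F (gaugeTimeReflect U)) * G' U)]
    refine integral_congr_ae (ae_of_all _ fun U => ?_)
    simp only [heΘ, gaugeTimeReflect_gaugeTimeReflect, mul_comm]
  · -- shift symmetry from `τ`-invariance and `τ ∘ Θ ∘ τ = Θ`
    simp only [osForm, Function.comp_apply]
    rw [← integral_comp_equiv_eq μ eτ hμτ (fun U => conj (F (gaugeTimeShift (gaugeTimeReflect U))) * G' U)]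
    refine integral_congr_ae (ae_of_all _ fun U => ?_)
    simp only [heτ, gaugeTimeShift_gaugeTimeReflect_gaugeTimeShift]
  · -- reflection positivity half a step up
    have h := hRP eτ hμτ (Or.inr heτ) F hF
    simpa only [osForm, heΘ, heτ, Function.comp_apply] using h

end Main


/-! ### The OS image of a continuous positive-time cylinder observable is that of its gauge average -/

section OSImage

variable {G : Type} [Group G] [TopologicalSpace G] [IsTopologicalGroup G] [CompactSpace G]
  [MeasurableSpace G] [BorelSpace G]

variable [SecondCountableTopology G] (r : LatticeRep G) {β : ℝ} {μ : Measure (LGConfig 4 G)}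
  [IsProbabilityMeasure μ]

/-- **The OS matrix elements against the gauge average**: for continuous positive-time cylinder
observables `D` (support `Λ`) and `F` (support `Λ'`),
`∫ D̄∘Θ · P F dμ = ∫ D̄∘Θ · F dμ` (Fubini, `D̄∘Θ` is blind to the averaged gauge transformations,
gauge invariance of `μ`). [folklore] -/
theorem integral_conj_reflect_mul_gaugeAvg (hμ : μ ∈ oddTorusLimitPoints r β) (hExt : CylinderExt G)
    {D F : LGConfig 4 G → ℂ} {Λ Λ' : Finset (QuantumLattice.ZdEdge 4)} (hD : IsCylinder D Λ)
    (hΛ : (↑Λ : Set (QuantumLattice.ZdEdge 4)) ⊆ posTimeEdges) (hDc : Continuous D) {CD : ℝ} (hCD : ∀ U, ‖D U‖ ≤ CD)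
    (hΛ' : (↑Λ' : Set (QuantumLattice.ZdEdge 4)) ⊆ posTimeEdges) (hFc : Continuous F) {CF : ℝ}
    (hCF : ∀ U, ‖F U‖ ≤ CF) :
    ∫ U, conj (D (gaugeTimeReflect U)) * gaugeAvg (ends Λ') F U ∂μ =
      ∫ U, conj (D (gaugeTimeReflect U)) * F U ∂μ := by
  set B := ends Λ' with hB
  -- pull the constant into the Haar integral and swap
  have h1 : (fun U => conj (D (gaugeTimeReflect U)) * gaugeAvg B F U) =
      fun U => ∫ γ, conj (D (gaugeTimeReflect U)) * F (gaugeTransformZd (extOne B γ) U) ∂(haarPi B) := by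
    funext U
    simp only [gaugeAvg, integral_const_mul]
  have hjoint : Continuous fun p : LGConfig 4 G × (↥B → G) =>
      conj (D (gaugeTimeReflect p.1)) * F (gaugeTransformZd (extOne B p.2) p.1) :=
    ((Complex.continuous_conj.comp (hDc.comp (continuous_gaugeTimeReflect.comp continuous_fst))).mul
      (hFc.comp ((continuous_gaugeTransformZd_extOne B).comp
        (continuous_snd.prodMk continuous_fst))))
  have hint : Integrable (Function.uncurry fun (U : LGConfig 4 G) (γ : ↥B → G) =>
      conj (D (gaugeTimeReflect U)) * F (gaugeTransformZd (extOne B γ) U)) (μ.prod (haarPi B)) := by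
    refine Integrable.of_bound hjoint.aestronglyMeasurable (CD * CF) (ae_of_all _ fun p => ?_)
    obtain ⟨U, γ⟩ := p
    simp only [Function.uncurry_apply_pair]
    rw [norm_mul, Complex.norm_conj]
    exact mul_le_mul (hCD _) (hCF _) (norm_nonneg _) ((norm_nonneg (D U)).trans (hCD U))
  rw [h1, integral_integral_swap hint]
  -- each inner integral is the same, by gauge invariance of `μ`
  have hinner : ∀ γ : ↥B → G,
      ∫ U, conj (D (gaugeTimeReflect U)) * F (gaugeTransformZd (extOne B γ) U) ∂μ =
        ∫ U, conj (D (gaugeTimeReflect U)) * F U ∂μ := by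
    intro γ
    have hφm : AEStronglyMeasurable (fun U => conj (D (gaugeTimeReflect U)) * F U)
        (μ.map (gaugeTransformZd (extOne B γ))) :=
      ((Complex.continuous_conj.comp (hDc.comp continuous_gaugeTimeReflect)).mul hFc)
        |>.measurable.aestronglyMeasurable
    calc ∫ U, conj (D (gaugeTimeReflect U)) * F (gaugeTransformZd (extOne B γ) U) ∂μ
        = ∫ U, conj (D (gaugeTimeReflect (gaugeTransformZd (extOne B γ) U))) *
            F (gaugeTransformZd (extOne B γ) U) ∂μ := by
          refine integral_congr_ae (ae_of_all _ fun U => ?_)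
          dsimp only
          rw [apply_gaugeTimeReflect_gaugeTransformZd_extOne hD hΛ hΛ' γ U]
      _ = ∫ U, conj (D (gaugeTimeReflect U)) * F U ∂(μ.map (gaugeTransformZd (extOne B γ))) :=
          (integral_map (measurable_gaugeTransformZd _).aemeasurable hφm).symm
      _ = ∫ U, conj (D (gaugeTimeReflect U)) * F U ∂μ := by
          rw [map_gaugeTransformZd_eq r hμ hExt]
  simp only [hinner, integral_const, probReal_univ, one_smul]

/-- **A continuous positive-time cylinder observable and its gauge average have the same OS
image** (`‖(F - P F)^‖² = Re ∫ (F - PF)‾∘Θ · (F - PF) = 0`). [folklore] -/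
theorem osMap_eq_osMap_gaugeAvg (hμ : μ ∈ oddTorusLimitPoints r β) (hExt : CylinderExt G)
    (h : IsOSReconstructible μ gaugeTimeReflect gaugeTimeShift (posTimeEvents G))
    {F : LGConfig 4 G → ℂ} {Λ : Finset (QuantumLattice.ZdEdge 4)} (hF : IsCylinder F Λ)
    (hΛ : (↑Λ : Set (QuantumLattice.ZdEdge 4)) ⊆ posTimeEdges) (hFc : Continuous F) {C : ℝ} (hC : ∀ U, ‖F U‖ ≤ C) :
    h.osMap F = h.osMap (gaugeAvg (ends Λ) F) := by
  have hFbm := isBoundedMeasurable_of_continuous hF hΛ hFc hC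
  have hQc : Continuous (gaugeAvg (ends Λ) F) := continuous_gaugeAvg _ hFc hC
  have hQcyl : IsCylinder (gaugeAvg (ends Λ) F) Λ := isCylinder_gaugeAvg _ hF
  have hQb : ∀ U, ‖gaugeAvg (ends Λ) F U‖ ≤ C := norm_gaugeAvg_le _ hC
  have hQbm := isBoundedMeasurable_of_continuous hQcyl hΛ hQc hQb
  -- the difference `D = F - P F`
  set D : LGConfig 4 G → ℂ := fun U => F U - gaugeAvg (ends Λ) F U with hDdef
  have hDcyl : IsCylinder D Λ := isCylinder_map₂ (fun a b : ℂ => a - b) hF hQcyl |>.mono ?_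
  swap
  · simp
  have hDc : Continuous D := hFc.sub hQc
  have hDb : ∀ U, ‖D U‖ ≤ C + C := fun U => (norm_sub_le _ _).trans (add_le_add (hC U) (hQb U))
  -- `b(D, D) = 0`
  have hzero : osForm μ gaugeTimeReflect D D = 0 := by
    have i1 : Integrable (fun U => conj (D (gaugeTimeReflect U)) * F U) μ := by
      refine Integrable.of_bound (((Complex.continuous_conj.comp
        (hDc.comp continuous_gaugeTimeReflect)).mul hFc).measurable.aestronglyMeasurable)
        ((C + C) * C) (ae_of_all _ fun U => ?_)
      rw [norm_mul, Complex.norm_conj]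
      exact mul_le_mul (hDb _) (hC _) (norm_nonneg _) ((norm_nonneg (D U)).trans (hDb U))
    have i2 : Integrable (fun U => conj (D (gaugeTimeReflect U)) * gaugeAvg (ends Λ) F U) μ := by
      refine Integrable.of_bound (((Complex.continuous_conj.comp
        (hDc.comp continuous_gaugeTimeReflect)).mul hQc).measurable.aestronglyMeasurable)
        ((C + C) * C) (ae_of_all _ fun U => ?_)
      rw [norm_mul, Complex.norm_conj]
      exact mul_le_mul (hDb _) (hQb _) (norm_nonneg _) ((norm_nonneg (D U)).trans (hDb U))
    have hsplit : osForm μ gaugeTimeReflect D D =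
        (∫ U, conj (D (gaugeTimeReflect U)) * F U ∂μ) -
          ∫ U, conj (D (gaugeTimeReflect U)) * gaugeAvg (ends Λ) F U ∂μ := by
      rw [osForm, ← integral_sub i1 i2]
      refine integral_congr_ae (ae_of_all _ fun U => ?_)
      simp only [hDdef, mul_sub]
    rw [hsplit, integral_conj_reflect_mul_gaugeAvg r hμ hExt hDcyl hΛ hDc hDb hΛ hFc hC, sub_self]
  -- hence the OS images coincide
  rw [h.osMap_eq hFbm, h.osMap_eq hQbm, ← sub_eq_zero, ← map_sub, ← norm_eq_zero,
    IsOSReconstructible.norm_vec, ← sq_eq_zero_iff, IsOSReconstructible.norm_pre_sq]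
  exact congrArg Complex.re hzero

end OSImage

/-! ### RQb1: density of the OS images of the span of `contPosTimeObs` -/

section Density

variable {G : Type} [Group G] [TopologicalSpace G] [IsTopologicalGroup G] [CompactSpace G]
  [MeasurableSpace G] [BorelSpace G] [SecondCountableTopology G]
  (r : LatticeRep G) {β : ℝ} {μ : Measure (LGConfig 4 G)} [IsProbabilityMeasure μ]

/-- The gauge average of a continuous positive-time cylinder observable lies in the complex span
of `contPosTimeObs G` (real and imaginary parts are gauge-averaged species). [folklore] -/
theorem gaugeAvg_mem_span {F : LGConfig 4 G → ℂ} {Λ : Finset (QuantumLattice.ZdEdge 4)} (hF : IsCylinder F Λ)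
    (hΛ : (↑Λ : Set (QuantumLattice.ZdEdge 4)) ⊆ posTimeEdges) (hFc : Continuous F) {C : ℝ} (hC : ∀ U, ‖F U‖ ≤ C) :
    gaugeAvg (ends Λ) F ∈ Submodule.span ℂ (contPosTimeObs G) := by
  -- real and imaginary parts
  set a : LGConfig 4 G → ℝ := fun U => (F U).re with ha
  set b : LGConfig 4 G → ℝ := fun U => (F U).im with hb
  have hac : Continuous a := Complex.continuous_re.comp hFc
  have hbc : Continuous b := Complex.continuous_im.comp hFc
  have hacyl : IsCylinder a Λ := fun U V hUV => by simp only [ha, hF hUV]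
  have hbcyl : IsCylinder b Λ := fun U V hUV => by simp only [hb, hF hUV]
  have haC : ∀ U, |a U| ≤ C := fun U => (Complex.abs_re_le_norm _).trans (hC U)
  have hbC : ∀ U, |b U| ≤ C := fun U => (Complex.abs_im_le_norm _).trans (hC U)
  set A := avgSpecies a Λ hacyl hac C haC with hA
  set Bs := avgSpecies b Λ hbcyl hbc C hbC with hBs
  have hAmem : (fun U => (A.F U : ℂ)) ∈ contPosTimeObs G :=
    ⟨A, continuous_gaugeAvg _ hac (C := C) (fun U => by rw [Real.norm_eq_abs]; exact haC U), hΛ, rfl⟩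
  have hBmem : (fun U => (Bs.F U : ℂ)) ∈ contPosTimeObs G :=
    ⟨Bs, continuous_gaugeAvg _ hbc (C := C) (fun U => by rw [Real.norm_eq_abs]; exact hbC U), hΛ, rfl⟩
  -- `P F = P a + i P b`
  have hdecomp : gaugeAvg (ends Λ) F =
      (fun U => (A.F U : ℂ)) + (Complex.I : ℂ) • fun U => (Bs.F U : ℂ) := by
    funext U
    rw [Pi.add_apply, Pi.smul_apply, smul_eq_mul, hA, hBs, avgSpecies_F, avgSpecies_F]
    simp only [gaugeAvg, ha, hb]
    have hi : Integrable (fun γ : ↥(ends Λ) → G => F (gaugeTransformZd (extOne (ends Λ) γ) U))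
        (haarPi (ends Λ)) :=
      Integrable.of_bound ((hFc.comp ((continuous_gaugeTransformZd_extOne (ends Λ)).comp
        (continuous_id.prodMk continuous_const))).aestronglyMeasurable) C
        (ae_of_all _ fun γ => hC _)
    have h1 := integral_re hi
    have h2 := integral_im hi
    simp only [RCLike.re_to_complex, RCLike.im_to_complex] at h1 h2
    apply Complex.ext
    · simp [← h1]
    · simp [← h2]
  rw [hdecomp]
  exact add_mem (Submodule.subset_span hAmem) (Submodule.smul_mem _ _ (Submodule.subset_span hBmem))

/-- **RQb1 — OS density of the continuous gauge-invariant positive-time observables** for an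
odd-torus limit state with the approximation property: the OS images of
`Submodule.span ℂ (contPosTimeObs G)` are dense in the OS Hilbert space. [folklore] -/
theorem dense_osMap_span (hμ : μ ∈ oddTorusLimitPoints r β) (hAP : CylinderApprox μ)
    (hExt : CylinderExt G)
    (h : IsOSReconstructible μ gaugeTimeReflect gaugeTimeShift (posTimeEvents G)) :
    Dense (h.osMap '' (Submodule.span ℂ (contPosTimeObs G) : Set (LGConfig 4 G → ℂ))) := by
  obtain ⟨eΘ, heΘ⟩ := exists_measurableEquiv_gaugeTimeReflect (G := G)
  have hμΘ : μ.map eΘ = μ := by rw [heΘ]; exact map_gaugeTimeReflect_eq r hμ hExt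
  set Sset := h.osMap '' (Submodule.span ℂ (contPosTimeObs G) : Set (LGConfig 4 G → ℂ)) with hS
  -- every OS image of a bounded positive-time observable is in the closure
  have hcl : ∀ Fp : h.PreSpace, h.vec Fp ∈ closure Sset := by
    intro Fp
    have hFbm := h.isBoundedMeasurable_fn Fp
    obtain ⟨hFm, C, hC⟩ := hFbm
    have hFm' : Measurable (h.fn Fp) := hFm.mono cylinderEvents_le_pi le_rfl
    refine Metric.mem_closure_iff.2 fun ε hε => ?_
    obtain ⟨F', Λ, hΛ, hcyl, hcont, hF'm, ⟨C', hC'⟩, hE⟩ :=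
      hAP (h.fn Fp) ⟨hFm, C, hC⟩ ((ε / 2) ^ 2) (by positivity)
    have hF'bm : IsBoundedMeasurable (posTimeEvents G) F' := ⟨hF'm, C', hC'⟩
    have hF'm' : Measurable F' := hF'm.mono cylinderEvents_le_pi le_rfl
    refine ⟨h.osMap (gaugeAvg (ends Λ) F'), ⟨_, gaugeAvg_mem_span hcyl hΛ hcont hC', rfl⟩, ?_⟩
    rw [← osMap_eq_osMap_gaugeAvg r hμ hExt h hcyl hΛ hcont hC', h.osMap_eq hF'bm, dist_eq_norm,
      ← map_sub, IsOSReconstructible.norm_vec]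
    -- `‖F - F'‖_{OS}² ≤ ∫ ‖F - F'‖² ≤ (ε/2)²`
    have hsq : ‖Fp - h.toPre hF'bm‖ ^ 2 ≤ (ε / 2) ^ 2 := by
      rw [IsOSReconstructible.norm_pre_sq]
      have hfn : h.fn (Fp - h.toPre hF'bm) = fun U => h.fn Fp U - F' U := rfl
      rw [hfn]
      refine (Complex.re_le_norm _).trans ?_
      have key := norm_integral_conj_mul_le μ (φ := fun U => h.fn Fp (eΘ U) - F' (eΘ U))
        (ψ := fun U => h.fn Fp U - F' U) ((hFm'.sub hF'm').comp eΘ.measurable) (hFm'.sub hF'm')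
        (A := C + C') (B := C + C')
        (fun U => (norm_sub_le _ _).trans (add_le_add (hC _) (hC' _)))
        (fun U => (norm_sub_le _ _).trans (add_le_add (hC _) (hC' _))) one_pos
      rw [integral_comp_equiv_eq μ eΘ hμΘ (fun U => ‖h.fn Fp U - F' U‖ ^ 2)] at key
      simp only [heΘ, div_one, one_mul, osForm] at key ⊢
      linarith
    have hn : ‖Fp - h.toPre hF'bm‖ ≤ ε / 2 := by
      nlinarith [norm_nonneg (Fp - h.toPre hF'bm), hε.le, hsq]
    linarith
  -- conclude by density of the range of `vec`
  have hsub : Set.range h.vec ⊆ closure Sset := by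
    rintro _ ⟨Fp, rfl⟩; exact hcl Fp
  exact dense_closure.1 (h.denseRange_vec.mono hsub)

end Density

end Summit.QuantumFields.YangMills.Theorems.CriticalContinuumLimit.AdmissibleGap

/-! ## Part 3 — the registered stub `stub_admissibleGivesGap` (I0 of line `Sketch`) -/

namespace Summit.QuantumFields.YangMills.Theorems.CriticalContinuumLimit

open Summit.QuantumFields.YangMills.Theorems.ClusteringToYangMills

variable {G : Type} [Group G] [TopologicalSpace G] [IsTopologicalGroup G] [CompactSpace G]
  [MeasurableSpace G] [BorelSpace G]

/-- **I0 — an admissible torus clustering rate is an infinite-volume transfer gap**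
(= `Statement.stub_requantise` (RQ) of line `spectral-requantisation-dock` of crux
`ClusteringToYangMills`): volume-uniform Euclidean-time clustering of the odd-torus Wilson states at
`β ≥ 0` with rate `m > 0` implies that every odd-torus limit state is Osterwalder–Schrader
reconstructible for `(gaugeTimeReflect, gaugeTimeShift, posTimeEvents G)` with transfer gap
`‖T|_{Ω^⊥}‖ ≤ e^{-m}`. Composition of RQ0 (`stub_cylinderApprox`: approximation property and
measure extensionality on the compact metrisable configuration space), RQa
(`AdmissibleGap.isOSReconstructible_of_oddTorusLimit`), RQb1 (`AdmissibleGap.dense_osMap_span`)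
and RQb2 (`stub_gapFromClustering`, Glimm–Jaffe 6.1.3 in dense form).
(Osterwalder–Seiler 1978 §2; Glimm–Jaffe 1987 §6.1, §19.7.) [folklore] -/
theorem stub_admissibleGivesGap (hG : IsCompactSimpleLieGroup G) (r : LatticeRep G) (β m : ℝ)
    (hβ : 0 ≤ β) (hm : 0 < m) (hEC : TorusClusteringAt r β m) :
    HasInfiniteVolumeGap r β m := by
  intro μ _ hμ
  obtain ⟨hAP, hExt⟩ := stub_cylinderApprox G hG
  obtain ⟨r₀⟩ := hG.2
  haveI : SecondCountableTopology G :=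
    (r₀.continuous.isClosedEmbedding r₀.injective).isEmbedding.secondCountableTopology
  have h : IsOSReconstructible μ gaugeTimeReflect gaugeTimeShift (posTimeEvents G) :=
    AdmissibleGap.isOSReconstructible_of_oddTorusLimit r hβ μ hμ (hAP μ) hExt
  exact ⟨h, stub_gapFromClustering G hG r β m hβ hm hEC μ hμ h
    (AdmissibleGap.dense_osMap_span r hμ (hAP μ) hExt h)⟩

end Summit.QuantumFields.YangMills.Theorems.CriticalContinuumLimit

end
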